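import Summits.HubbardSuperconductivity.HubbardSuperconductivity.Theorems.LevyLogBootstrapDressHalfFilledSectorFloors
import HarnessLib

/-!
# Crux `DressHalfFilled` (stmt-HubbardSuperconductivity-8148, route `LevyLogBootstrap`; shared with route
# `AnisotropyChord`): the charge-sector energies `E(0), …, E(8)` of the `2 × 2` Hubbard plaquette

Support file (`--supports stmt-HubbardSuperconductivity-8148`) for STUB 1 `stub_plaquetteData` of the line
`Cruxes/DressHalfFilled/Lines/birth.lean` (verbatim `stub_kineticGlueInWindow` of `Cruxes/DressAnyFilling/Lines/birth.lean`,
stmt-HubbardSuperconductivity-10291), continuing `LevyLogBootstrapDressHalfFilledSectorFloors`: for every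
`U ∈ [2, 4]`, certified bounds on the charge-sector ground energies `E(n) = groundEnergyAt plaquetteGraph 1 U n`
of one isolated plaquette, assembled sector by sector (`(N↑, N↓) = (a, b)`, `a + b = n`) from the plaquette-level
form bounds of the CooperPairDMott certified exact diagonalisation (`plaq{ab}_lb`, Gershgorin / Gram certificates)
and the two new floors of the previous file:

`0 ≤ E(0)`, `-2 ≤ E(1)`, `-4 ≤ E(2) ≤ ē₂(U)`, `E(3) ≥` the per-half-interval `(2,1)`/`(1,2)` chords (and the coarse
`-33/10`), `-4 ≤ E(4) ≤ ē₄(U)`, `E(5) ≥ chord₃₂(U)`, `E(6) ≥ 2U - 4`, `E(7) ≥ 3U - 2`, `E(8) ≥ 4U`, and PAIR BINDING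
for the charge-sector energies, `E(2) + E(4) < 2E(3)` (the tree's `stub_plaquettePairBinding` is the same
inequality for the spin-sector minima `e₂⁰, e₄⁰, e₃^½`; here `E(3)` is the minimum over ALL four spin sectors of
charge `3`). These feed the strict chord condition (W3) of `PlaquetteData U`
(`LevyLogBootstrapDressHalfFilledPlaquetteData`).

Sources: W.-F. Tsai, S. A. Kivelson, PRB 73 (2006) 214510, Table I; E. H. Lieb, PRL 62 (1989) 1201, eq. (4).
Only kernel-checked integer arithmetic is trusted. No definition and no named fact is introduced.
-/

noncomputable section

set_option linter.dupNamespace false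

namespace Summit.HubbardSuperconductivity.HubbardSuperconductivity.Theorems.LevyLogBootstrap

open Matrix Finset Literature.MathematicalPhysics.QuantumLattice
open Literature.MathematicalPhysics.QuantumLattice.TwoSpecies
open Summit.HubbardSuperconductivity.HubbardSuperconductivity.Theorems.CooperPairDMottWalk
open scoped ComplexOrder

section Plaquette

variable {U : ℝ}

/-! ### The charge-sector energies `E(n) = groundEnergyAt plaquetteGraph 1 U n` of the plaquette -/

/-- `|PlaquetteSite| = 4`, as an instance-free rewriting aid. [folklore] -/
private theorem card4 : Fintype.card PlaquetteSite = 4 := card_plaquetteSite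

/-- Lower bound on `E(n)` from the plaquette-level sector bounds `plaq{ab}_lb`, `a + b = n`: the
bookkeeping wrapper of `le_groundEnergyAt_of_sectorBounds` for the plaquette. [folklore] -/
theorem le_plaquetteEnergyAt (θ : ℝ) {N : ℕ} (hN : N ≤ 8)
    (h : ∀ a b : ℕ, a ≤ 4 → b ≤ 4 → a + b = N → ∀ v : Fock (Orb PlaquetteSite), IsInSector a b v →
      θ * (star v ⬝ᵥ v).re ≤ (star v ⬝ᵥ (plaquetteHamiltonian U *ᵥ v)).re) :
    θ ≤ groundEnergyAt plaquetteGraph 1 U N :=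
  le_groundEnergyAt_of_sectorBounds plaquetteGraph 1 U θ (by rw [card4]; omega)
    fun a b ha hb hab v hv => h a b (by rw [card4] at ha; exact ha) (by rw [card4] at hb; exact hb) hab v hv

/-- `E(0) ≥ 0` (the vacuum sector). [folklore] -/
theorem plaquetteE0_ge (hU2 : 2 ≤ U) : (0 : ℝ) ≤ groundEnergyAt plaquetteGraph 1 U 0 := by
  refine le_plaquetteEnergyAt 0 (by norm_num) fun a b ha hb hab v hv => ?_
  obtain ⟨rfl, rfl⟩ : a = 0 ∧ b = 0 := by omega
  exact plaq00_lb hU2 v hv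

/-- `E(1) ≥ -2` (one electron: the bottom of the band of the 4-cycle). [folklore] -/
theorem plaquetteE1_ge (hU2 : 2 ≤ U) : (-2 : ℝ) ≤ groundEnergyAt plaquetteGraph 1 U 1 := by
  refine le_plaquetteEnergyAt (-2) (by norm_num) fun a b ha hb hab v hv => ?_
  rcases (by omega : (a = 1 ∧ b = 0) ∨ (a = 0 ∧ b = 1)) with ⟨rfl, rfl⟩ | ⟨rfl, rfl⟩
  · exact plaq10_lb hU2 v hv
  · exact plaq01_lb hU2 v hv

/-- `E(2) ≥ -4` (two electrons; Gershgorin on `(1,1)`, the sharp `-(5/2)` on `(2,0)`, `(0,2)`). [folklore] -/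
theorem plaquetteE2_ge (hU2 : 2 ≤ U) : (-4 : ℝ) ≤ groundEnergyAt plaquetteGraph 1 U 2 := by
  refine le_plaquetteEnergyAt (-4) (by norm_num) fun a b ha hb hab v hv => ?_
  rcases (by omega : (a = 2 ∧ b = 0) ∨ (a = 1 ∧ b = 1) ∨ (a = 0 ∧ b = 2)) with
    ⟨rfl, rfl⟩ | ⟨rfl, rfl⟩ | ⟨rfl, rfl⟩
  · have := plaq20s_lb hU2 v hv
    linarith [normSq_re_nonneg v]
  · exact plaq11_lb hU2 v hv
  · have := plaq02s_lb hU2 v hv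
    linarith [normSq_re_nonneg v]

/-- `E(3) ≥ λ` whenever `λ ≤ -2` bounds the `(2,1)` form (hence the `(1,2)` form) from below: the
sectors `(3,0)`, `(0,3)` sit at `≥ -2`. [folklore] -/
theorem plaquetteE3_ge_of_form (hU2 : 2 ≤ U) {lam : ℝ} (hlam : lam ≤ -2)
    (h : ∀ x : Fin 6 → Fin 4 → ℝ, lam * nsqR x ≤ hopR K2 K1 x + U * dblR d21 x) :
    lam ≤ groundEnergyAt plaquetteGraph 1 U 3 := by
  obtain ⟨h21, h12⟩ := plaq21_plaq12_of_form (U := U) h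
  refine le_plaquetteEnergyAt lam (by norm_num) fun a b ha hb hab v hv => ?_
  rcases (by omega : (a = 3 ∧ b = 0) ∨ (a = 2 ∧ b = 1) ∨ (a = 1 ∧ b = 2) ∨ (a = 0 ∧ b = 3)) with
    ⟨rfl, rfl⟩ | ⟨rfl, rfl⟩ | ⟨rfl, rfl⟩ | ⟨rfl, rfl⟩
  · have := plaq30_lb hU2 v hv
    nlinarith [normSq_re_nonneg v]
  · exact h21 v hv
  · exact h12 v hv
  · have := plaq03_lb hU2 v hv
    nlinarith [normSq_re_nonneg v]

/-- `E(4) ≥ -4` (half filling: `(4,0)`, `(0,4)` at `≥ 0`; `(3,1)`, `(1,3)` at `≥ e₄⁰ + 1/20` with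
`e₄⁰ ≥ -4` by the new `(2,2)` floor; `(2,2)` at `≥ -4`). [folklore] -/
theorem plaquetteE4_ge (hU2 : 2 ≤ U) (hU4 : U ≤ 4) : (-4 : ℝ) ≤ groundEnergyAt plaquetteGraph 1 U 4 := by
  have he4 : (-4 : ℝ) ≤ (plaquetteHamiltonian U).minEnergyOn (szSector 4 0) := by
    have h := le_minEnergyOn_szSector_of_sectorBound plaquetteGraph 1 U (-4) (a := 2) (b := 2)
      (by rw [card4]; omega) (by rw [card4]; omega) (plaq22_abs_lb hU2 hU4)
    have hs : (szSector (2 + 2) ((((2 : ℕ) : ℝ) - ((2 : ℕ) : ℝ)) / 2) :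
        Submodule ℂ (Fock (Orb PlaquetteSite))) = szSector 4 0 := by norm_num
    rwa [hs] at h
  refine le_plaquetteEnergyAt (-4) (by norm_num) fun a b ha hb hab v hv => ?_
  rcases (by omega : (a = 4 ∧ b = 0) ∨ (a = 3 ∧ b = 1) ∨ (a = 2 ∧ b = 2) ∨ (a = 1 ∧ b = 3) ∨
      (a = 0 ∧ b = 4)) with ⟨rfl, rfl⟩ | ⟨rfl, rfl⟩ | ⟨rfl, rfl⟩ | ⟨rfl, rfl⟩ | ⟨rfl, rfl⟩
  · have := plaq40_lb hU2 v hv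
    nlinarith [normSq_re_nonneg v]
  · have := plaq31_lb hU2 hU4 v hv
    nlinarith [normSq_re_nonneg v]
  · exact plaq22_abs_lb hU2 hU4 v hv
  · have := plaq13_lb hU2 hU4 v hv
    nlinarith [normSq_re_nonneg v]
  · have := plaq04_lb hU2 v hv
    nlinarith [normSq_re_nonneg v]

/-- `E(5) ≥ chord₃₂(U) = (4-U)/2 · (-1.211) + (U-2)/2 · 1.246` (sectors `(3,2)`, `(2,3)`; the sectors
`(4,1)`, `(1,4)` sit at `≥ U - 2 ≥ chord₃₂(U)`). [folklore] -/
theorem plaquetteE5_ge (hU2 : 2 ≤ U) (hU4 : U ≤ 4) :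
    (4 - U) / 2 * (-1211 / 1000) + (U - 2) / 2 * (1246 / 1000) ≤ groundEnergyAt plaquetteGraph 1 U 5 := by
  refine le_plaquetteEnergyAt _ (by norm_num) fun a b ha hb hab v hv => ?_
  rcases (by omega : (a = 4 ∧ b = 1) ∨ (a = 3 ∧ b = 2) ∨ (a = 2 ∧ b = 3) ∨ (a = 1 ∧ b = 4)) with
    ⟨rfl, rfl⟩ | ⟨rfl, rfl⟩ | ⟨rfl, rfl⟩ | ⟨rfl, rfl⟩
  · have := plaq41_lb hU2 hU4 v hv
    nlinarith [normSq_re_nonneg v]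
  · exact plaq32_lb hU2 hU4 v hv
  · exact plaq23_lb hU2 hU4 v hv
  · have := plaq14_lb hU2 hU4 v hv
    nlinarith [normSq_re_nonneg v]

/-- `E(6) ≥ 2U - 4` (sectors `(4,2)`, `(3,3)`, `(2,4)`). [folklore] -/
theorem plaquetteE6_ge (hU2 : 2 ≤ U) (hU4 : U ≤ 4) : 2 * U - 4 ≤ groundEnergyAt plaquetteGraph 1 U 6 := by
  refine le_plaquetteEnergyAt _ (by norm_num) fun a b ha hb hab v hv => ?_
  rcases (by omega : (a = 4 ∧ b = 2) ∨ (a = 3 ∧ b = 3) ∨ (a = 2 ∧ b = 4)) with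
    ⟨rfl, rfl⟩ | ⟨rfl, rfl⟩ | ⟨rfl, rfl⟩
  · exact plaq42_lb hU2 hU4 v hv
  · exact plaq33_lb hU2 hU4 v hv
  · exact plaq24_lb hU2 hU4 v hv

/-- `E(7) ≥ 3U - 2` (sectors `(4,3)`, `(3,4)`). [folklore] -/
theorem plaquetteE7_ge (hU2 : 2 ≤ U) (hU4 : U ≤ 4) : 3 * U - 2 ≤ groundEnergyAt plaquetteGraph 1 U 7 := by
  refine le_plaquetteEnergyAt _ (by norm_num) fun a b ha hb hab v hv => ?_
  rcases (by omega : (a = 4 ∧ b = 3) ∨ (a = 3 ∧ b = 4)) with ⟨rfl, rfl⟩ | ⟨rfl, rfl⟩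
  · exact plaq43_lb hU2 hU4 v hv
  · exact plaq34_lb hU2 hU4 v hv

/-- `E(8) ≥ 4U` (the full sector `(4,4)`). [folklore] -/
theorem plaquetteE8_ge (hU2 : 2 ≤ U) (hU4 : U ≤ 4) : 4 * U ≤ groundEnergyAt plaquetteGraph 1 U 8 := by
  refine le_plaquetteEnergyAt _ (by norm_num) fun a b ha hb hab v hv => ?_
  obtain ⟨rfl, rfl⟩ : a = 4 ∧ b = 4 := by omega
  exact plaq44_lb hU2 hU4 v hv

/-- `E(2) ≤ e₂⁰ = minEnergyOn (szSector 2 0)` (the `(1,1)` sector energy). [folklore] -/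
theorem plaquetteE2_le_e2 (U : ℝ) :
    groundEnergyAt plaquetteGraph 1 U 2 ≤ (plaquetteHamiltonian U).minEnergyOn (szSector 2 0) := by
  have h := groundEnergyAt_le_minEnergyOn_szSector plaquetteGraph 1 U (a := 1) (b := 1)
    (by rw [card4]; norm_num) (by rw [card4]; norm_num)
  have hs : (szSector (1 + 1) ((((1 : ℕ) : ℝ) - ((1 : ℕ) : ℝ)) / 2) :
      Submodule ℂ (Fock (Orb PlaquetteSite))) = szSector 2 0 := by norm_num
  rwa [hs] at h

/-- `E(4) ≤ e₄⁰ = minEnergyOn (szSector 4 0)` (the `(2,2)` sector energy). [folklore] -/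
theorem plaquetteE4_le_e4 (U : ℝ) :
    groundEnergyAt plaquetteGraph 1 U 4 ≤ (plaquetteHamiltonian U).minEnergyOn (szSector 4 0) := by
  have h := groundEnergyAt_le_minEnergyOn_szSector plaquetteGraph 1 U (a := 2) (b := 2)
    (by rw [card4]; omega) (by rw [card4]; omega)
  have hs : (szSector (2 + 2) ((((2 : ℕ) : ℝ) - ((2 : ℕ) : ℝ)) / 2) :
      Submodule ℂ (Fock (Orb PlaquetteSite))) = szSector 4 0 := by norm_num
  rwa [hs] at h

/-- `E(2) ≤ ē₂(U) = (-387846368 + 12630916 U)/99994588` (trial-array bound `e2_le_0`, valid for all `U`).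
[folklore] -/
theorem plaquetteE2_le (U : ℝ) :
    groundEnergyAt plaquetteGraph 1 U 2 ≤ (-387846368 + U * 12630916) / 99994588 :=
  (plaquetteE2_le_e2 U).trans (e2_le_0 U)

/-- `E(4) ≤ ē₄(U) = (-367862976 + 42700248 U)/99979286` (trial-array bound `e4_le_0`, valid for all `U`).
[folklore] -/
theorem plaquetteE4_le (U : ℝ) :
    groundEnergyAt plaquetteGraph 1 U 4 ≤ (-367862976 + U * 42700248) / 99979286 :=
  (plaquetteE4_le_e4 U).trans (e4_le_0 U)

/-- **Pair binding for the charge-sector energies**: `E(2) + E(4) < 2 E(3)` for `U ∈ [2, 4]` (per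
half-interval: the trial-array upper bounds `e2_le_j`, `e4_le_j` against the certified `(2,1)`/`(1,2)` chords;
margins `0.01–0.03` as in `stub_plaquettePairBinding`). Tsai–Kivelson 2006, eq. (2). [folklore] -/
theorem plaquette_pairBinding (hU2 : 2 ≤ U) (hU4 : U ≤ 4) :
    groundEnergyAt plaquetteGraph 1 U 2 + groundEnergyAt plaquetteGraph 1 U 4 <
      2 * groundEnergyAt plaquetteGraph 1 U 3 := by
  have h2 := plaquetteE2_le_e2 U
  have h4 := plaquetteE4_le_e4 U
  rcases le_or_gt U (5 / 2) with hUa | hUa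
  · have h3 := plaquetteE3_ge_of_form hU2 (by nlinarith) (form21_half_0 hU2 hUa)
    linarith [e2_le_0 U, e4_le_0 U]
  rcases le_or_gt U 3 with hUb | hUb
  · have h3 := plaquetteE3_ge_of_form hU2 (by nlinarith) (form21_half_1 hUa.le hUb)
    linarith [e2_le_1 U, e4_le_1 U]
  rcases le_or_gt U (7 / 2) with hUc | hUc
  · have h3 := plaquetteE3_ge_of_form hU2 (by nlinarith) (form21_half_2 hUb.le hUc)
    linarith [e2_le_2 U, e4_le_2 U]
  · have h3 := plaquetteE3_ge_of_form hU2 (by nlinarith) (form21_half_3 hUc.le hU4)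
    linarith [e2_le_3 U, e4_le_3 U]

/-- A coarse floor `E(3) ≥ -33/10` on all of `[2, 4]` (the `(2,1)` chord is `≥ -3.211`). [folklore] -/
theorem plaquetteE3_ge (hU2 : 2 ≤ U) (hU4 : U ≤ 4) : (-(33 / 10) : ℝ) ≤ groundEnergyAt plaquetteGraph 1 U 3 := by
  have h := plaquetteE3_ge_of_form hU2 (lam := (4 - U) / 2 * (-3211 / 1000) + (U - 2) / 2 * (-2754 / 1000))
    (by nlinarith) (form21_chord hU2 hU4)
  nlinarith

end Plaquette

/-! ### Registered sub-goal of the crux item (stmt-HubbardSuperconductivity-8148) -/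

set_option linter.style.longLine false in
/-- Registered sub-goal `dressHalfFilled_plaquettePairBindingCharge` of the crux item: pair binding for the CHARGE-sector energies of
the plaquette, `E(2) + E(4) < 2E(3)` on `[2, 4]` (closed restatement of `plaquette_pairBinding`). [folklore] -/
theorem dressHalfFilled_plaquettePairBindingCharge : ∀ {U : ℝ}, 2 ≤ U → U ≤ 4 → Literature.MathematicalPhysics.QuantumLattice.groundEnergyAt Literature.MathematicalPhysics.QuantumLattice.plaquetteGraph 1 U 2 + Literature.MathematicalPhysics.QuantumLattice.groundEnergyAt Literature.MathematicalPhysics.QuantumLattice.plaquetteGraph 1 U 4 < 2 * Literature.MathematicalPhysics.QuantumLattice.groundEnergyAt Literature.MathematicalPhysics.QuantumLattice.plaquetteGraph 1 U 3 :=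
  fun hU2 hU4 => plaquette_pairBinding hU2 hU4

end Summit.HubbardSuperconductivity.HubbardSuperconductivity.Theorems.LevyLogBootstrap

end
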